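import Mathlib
import Summits.AtomisticToContinuum.Crystallization.Theorems.BraggSlacknessRigidityHcpDiffractionRigidityQuietCentresAux
import Summits.AtomisticToContinuum.Crystallization.Theorems.BraggSlacknessRigidityHcpDiffractionRigidityLocalLimitTransferAux
import Summits.AtomisticToContinuum.Crystallization.Theorems.BraggSlacknessRigidityHcpDiffractionRigidityEssentialPeriodicityRatAux

/-!
# Quietness off the periodised Bragg set (stub `stub_essentialPeriodicityRat` of crux
# `HcpDiffractionRigidity`, item `stmt-AtomisticToContinuum-13166`, Aux file 5)

Let `Λ ⊆ ℝ³` be `δ`-separated and *Gaussian-quiet* along scales `L t → ∞`: for every admissible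
test function `g` (continuous, compact support off the Bragg set
`Z = {0} ∪ ⋃_{k ∈ L*} {|ξ| = |k|}` of a periodic template) and every `ε > 0`, eventually
`∫ g |S_t|² ≤ ε MG_t` (`S_t` the Gaussian-weighted structure factor, `MG_t` the Gaussian mass).
Let `V` be a set of *periods*: `⟨m, s⟩ ∈ ℤ` for `m ∈ V`, `s ∈ Λ`, so that `|S_t|²` is
`V`-periodic (Aux file 1).

* `isOpen_setOf_admissible` — the complement of the Bragg set is open (uniform gap
  `HcpRigidityQuietCentres.exists_gap`);
* `eventually_abs_integral_le_of_shift` — **quietness off the periodised Bragg set**: if every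
  point `ξ` of `tsupport g` has a period `m ∈ V` with `ξ + m ∉ Z`, then `|∫ g |S_t|²| ≤ ε MG_t`
  eventually (finite subcover of `tsupport g` by the open sets `{ξ : ξ + m ∉ Z}`, a continuous
  partition of unity `exists_continuous_sum_one_of_isOpen_isCompact`, and the exact invariance
  `∫ gᵢ(ξ - mᵢ)|S_t|² = ∫ gᵢ |S_t|²`, the shifted pieces being admissible).

All `[folklore]`.
-/

noncomputable section

namespace Summit.AtomisticToContinuum.Crystallization.Theorems

namespace HcpRigiditySpectral

open MeasureTheory Complex Filter Metric Set
open scoped BigOperators Real RealInnerProductSpace Topology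
open Literature.MathematicalPhysics.StatisticalMechanics
open Summit.AtomisticToContinuum.Crystallization.Theorems.HcpRigidityQuietCentres
open Summit.AtomisticToContinuum.Crystallization.Theorems.HcpRigidityLocalLimit

/-! ## The Bragg set is closed -/

/-- **The admissible region is open.** The set of `η ≠ 0` with `|η| ≠ |k|` for every vector `k`
of the dual of the lattice of `P` is open (uniform gap about a point). [folklore] -/
theorem isOpen_setOf_admissible (P : PeriodicConfiguration 3) :
    IsOpen {η : EuclideanSpace ℝ (Fin 3) | η ≠ 0 ∧ ∀ k : EuclideanSpace ℝ (Fin 3),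
      (∀ g ∈ P.lattice, ∃ n : ℤ, ⟪k, g⟫ = (n : ℝ)) → ‖η‖ ≠ ‖k‖} := by
  rw [Metric.isOpen_iff]
  intro η hη
  set f : EuclideanSpace ℝ (Fin 3) → ℝ := ({η} : Set (EuclideanSpace ℝ (Fin 3))).indicator
    fun _ => 1 with hf
  have hsupp : tsupport f = {η} := by
    rw [tsupport, hf, Set.support_indicator, Function.support_const one_ne_zero, Set.inter_univ,
      closure_singleton]
  have hcs : HasCompactSupport f := by
    rw [HasCompactSupport, hsupp]; exact isCompact_singleton
  obtain ⟨d, hd, hgap⟩ := exists_gap P hcs (by rw [hsupp]; rintro ξ rfl; exact hη)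
  refine ⟨d, hd, fun η' hη' => ?_⟩
  rw [mem_ball] at hη'
  have hηmem : η ∈ tsupport f := by rw [hsupp]; exact rfl
  have hle : |‖η‖ - ‖η'‖| ≤ dist η' η := by
    rw [dist_comm, dist_eq_norm]; exact abs_norm_sub_norm_le η η'
  constructor
  · intro h0
    rw [h0] at hη' hle
    have h1 := hgap η hηmem 0 (fun g _ => ⟨0, by simp⟩)
    rw [norm_zero, sub_zero, abs_of_nonneg (norm_nonneg η)] at h1 hle
    linarith
  · intro k hk heq
    have h1 := hgap η hηmem k hk
    rw [← heq] at h1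
    linarith

/-- Points of the topological support of `ξ ↦ g(ξ - m)` are shifts by `m` of points of the
topological support of `g`. [folklore] -/
theorem sub_mem_tsupport_of_mem_tsupport_comp_sub {g : EuclideanSpace ℝ (Fin 3) → ℝ}
    (m : EuclideanSpace ℝ (Fin 3)) {ξ : EuclideanSpace ℝ (Fin 3)}
    (hξ : ξ ∈ tsupport (fun x => g (x - m))) : ξ - m ∈ tsupport g := by
  by_contra h
  rw [notMem_tsupport_iff_eventuallyEq] at h
  have hc : Tendsto (fun x : EuclideanSpace ℝ (Fin 3) => x - m) (𝓝 ξ) (𝓝 (ξ - m)) :=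
    (continuous_sub_right m).tendsto ξ
  have h2 : (fun x => g (x - m)) =ᶠ[𝓝 ξ] 0 := hc.eventually h
  exact (notMem_tsupport_iff_eventuallyEq.2 h2) hξ

/-! ## Quietness off the periodised Bragg set -/

/-- **Quietness off the periodised Bragg set.** Let `Λ ⊆ ℝ³` be `δ`-separated and Gaussian-quiet
along `L t → ∞` for the admissible test functions of the template `P`, and let `V` be a set of
periods (`⟨m, s⟩ ∈ ℤ` for `m ∈ V`, `s ∈ Λ`). If `g` is continuous with compact support and every
`ξ ∈ tsupport g` has some `m ∈ V` with `ξ + m` admissible (`≠ 0` and off every Bragg sphere), then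
for every `ε > 0`, eventually `|∫ g |S_t|²| ≤ ε MG_t`. [folklore] -/
theorem eventually_abs_integral_le_of_shift {P : PeriodicConfiguration 3}
    {Λ : Set (EuclideanSpace ℝ (Fin 3))} {δ : ℝ} (hδ : 0 < δ)
    (hΛ : ∀ p ∈ Λ, ∀ q ∈ Λ, p ≠ q → δ ≤ dist p q) {L : ℕ → ℝ} (hL : Tendsto L atTop atTop)
    (hquiet : ∀ g : EuclideanSpace ℝ (Fin 3) → ℝ, Continuous g → HasCompactSupport g →
      (∀ ξ ∈ tsupport g, ξ ≠ 0 ∧ ∀ k : EuclideanSpace ℝ (Fin 3),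
        (∀ v ∈ P.lattice, ∃ n : ℤ, ⟪k, v⟫ = (n : ℝ)) → ‖ξ‖ ≠ ‖k‖) →
      ∀ ε : ℝ, 0 < ε → ∀ᶠ t : ℕ in atTop,
        (∫ ξ : EuclideanSpace ℝ (Fin 3), g ξ *
          ‖∑' s : Λ, (Real.exp (-(‖(s : EuclideanSpace ℝ (Fin 3))‖ ^ 2) / L t ^ 2) : ℂ) *
            cexp (2 * Real.pi * I * (⟪ξ, (s : EuclideanSpace ℝ (Fin 3))⟫ : ℂ))‖ ^ 2) ≤
        ε * ∑' s : Λ, Real.exp (-(‖(s : EuclideanSpace ℝ (Fin 3))‖ ^ 2) / L t ^ 2) ^ 2)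
    {V : Set (EuclideanSpace ℝ (Fin 3))} (hV : ∀ m ∈ V, ∀ s ∈ Λ, ∃ n : ℤ, ⟪m, s⟫ = (n : ℝ))
    {g : EuclideanSpace ℝ (Fin 3) → ℝ} (hgc : Continuous g) (hgs : HasCompactSupport g)
    (hg : ∀ ξ ∈ tsupport g, ∃ m ∈ V, ξ + m ≠ 0 ∧ ∀ k : EuclideanSpace ℝ (Fin 3),
      (∀ v ∈ P.lattice, ∃ n : ℤ, ⟪k, v⟫ = (n : ℝ)) → ‖ξ + m‖ ≠ ‖k‖)
    {ε : ℝ} (hε : 0 < ε) :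
    ∀ᶠ t : ℕ in atTop,
      |∫ ξ : EuclideanSpace ℝ (Fin 3), g ξ *
          ‖∑' s : Λ, (Real.exp (-(‖(s : EuclideanSpace ℝ (Fin 3))‖ ^ 2) / L t ^ 2) : ℂ) *
            cexp (2 * Real.pi * I * (⟪ξ, (s : EuclideanSpace ℝ (Fin 3))⟫ : ℂ))‖ ^ 2| ≤
        ε * ∑' s : Λ, Real.exp (-(‖(s : EuclideanSpace ℝ (Fin 3))‖ ^ 2) / L t ^ 2) ^ 2 := by
  -- two-sided quietness for admissible test functions
  have hq2 : ∀ g' : EuclideanSpace ℝ (Fin 3) → ℝ, Continuous g' → HasCompactSupport g' →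
      (∀ ξ ∈ tsupport g', ξ ≠ 0 ∧ ∀ k : EuclideanSpace ℝ (Fin 3),
        (∀ v ∈ P.lattice, ∃ n : ℤ, ⟪k, v⟫ = (n : ℝ)) → ‖ξ‖ ≠ ‖k‖) →
      ∀ ε' : ℝ, 0 < ε' → ∀ᶠ t : ℕ in atTop,
        |∫ ξ : EuclideanSpace ℝ (Fin 3), g' ξ *
          ‖∑' s : Λ, (Real.exp (-(‖(s : EuclideanSpace ℝ (Fin 3))‖ ^ 2) / L t ^ 2) : ℂ) *
            cexp (2 * Real.pi * I * (⟪ξ, (s : EuclideanSpace ℝ (Fin 3))⟫ : ℂ))‖ ^ 2| ≤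
        ε' * ∑' s : Λ, Real.exp (-(‖(s : EuclideanSpace ℝ (Fin 3))‖ ^ 2) / L t ^ 2) ^ 2 := by
    intro g' hc hs hadm ε' hε'
    have hts : tsupport (fun x => -g' x) = tsupport g' := tsupport_neg g'
    have hneg := hquiet (fun x => -g' x) hc.neg hs.neg (by rw [hts]; exact hadm) ε' hε'
    filter_upwards [hquiet g' hc hs hadm ε' hε', hneg] with t h1 h2
    simp only [neg_mul, integral_neg] at h2
    rw [abs_le]
    exact ⟨by linarith, h1⟩
  -- the open admissible region and the cover of the support
  set A : Set (EuclideanSpace ℝ (Fin 3)) := {η | η ≠ 0 ∧ ∀ k : EuclideanSpace ℝ (Fin 3),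
    (∀ v ∈ P.lattice, ∃ n : ℤ, ⟪k, v⟫ = (n : ℝ)) → ‖η‖ ≠ ‖k‖} with hAdef
  have hA : IsOpen A := isOpen_setOf_admissible P
  set K : Set (EuclideanSpace ℝ (Fin 3)) := tsupport g with hKdef
  have hK : IsCompact K := hgs
  choose m hmV hmA using hg
  set U : K → Set (EuclideanSpace ℝ (Fin 3)) := fun x => (fun η => η + m x.1 x.2) ⁻¹' A with hUdef
  have hUo : ∀ x, IsOpen (U x) := fun x => hA.preimage (by fun_prop)
  have hcov : K ⊆ ⋃ x, U x := fun ξ hξ => mem_iUnion.2 ⟨⟨ξ, hξ⟩, hmA ξ hξ⟩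
  obtain ⟨T, hT⟩ := hK.elim_finite_subcover U hUo hcov
  -- reindex the finite subcover by `Fin T.card`
  set sU : Fin T.card → Set (EuclideanSpace ℝ (Fin 3)) := fun i => U (T.equivFin.symm i).1
    with hsUdef
  have hso : ∀ i, IsOpen (sU i) := fun i => hUo _
  have hKs : K ⊆ ⋃ i, sU i := by
    intro ξ hξ
    obtain ⟨x, hxT, hξx⟩ := mem_iUnion₂.1 (hT hξ)
    refine mem_iUnion.2 ⟨T.equivFin ⟨x, hxT⟩, ?_⟩
    show ξ ∈ U (T.equivFin.symm (T.equivFin ⟨x, hxT⟩)).1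
    rw [Equiv.symm_apply_apply]
    exact hξx
  obtain ⟨ρ, hρs, hρ1, -, -⟩ := exists_continuous_sum_one_of_isOpen_isCompact hso hK hKs
  -- the pieces `gᵢ = ρᵢ g` and their shifts `μ i`
  obtain ⟨μ, hμ⟩ : ∃ μ : Fin T.card → EuclideanSpace ℝ (Fin 3),
      ∀ i, μ i = m (T.equivFin.symm i).1.1 (T.equivFin.symm i).1.2 := ⟨_, fun _ => rfl⟩
  obtain ⟨gi, hgi⟩ : ∃ gi : Fin T.card → EuclideanSpace ℝ (Fin 3) → ℝ,
      ∀ i, gi i = fun x => ρ i x * g x := ⟨_, fun _ => rfl⟩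
  have hgi_c : ∀ i, Continuous (gi i) := fun i => by rw [hgi]; exact (ρ i).continuous.mul hgc
  have hgi_s : ∀ i, HasCompactSupport (gi i) := fun i => by rw [hgi]; exact hgs.mul_left
  have hsum : ∀ x, g x = ∑ i, gi i x := by
    intro x
    by_cases hx : x ∈ K
    · have h1 := hρ1 hx
      rw [Finset.sum_apply, Pi.one_apply] at h1
      simp only [hgi]
      rw [← Finset.sum_mul, h1, one_mul]
    · have h0 : g x = 0 := image_eq_zero_of_notMem_tsupport hx
      simp only [hgi, h0, mul_zero, Finset.sum_const_zero]
  -- the shifted pieces are admissible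
  have hadm : ∀ i, ∀ ξ ∈ tsupport (fun x => gi i (x - μ i)), ξ ≠ 0 ∧
      ∀ k : EuclideanSpace ℝ (Fin 3), (∀ v ∈ P.lattice, ∃ n : ℤ, ⟪k, v⟫ = (n : ℝ)) → ‖ξ‖ ≠ ‖k‖ := by
    intro i ξ hξ
    have h1 : ξ - μ i ∈ tsupport (gi i) := sub_mem_tsupport_of_mem_tsupport_comp_sub (μ i) hξ
    rw [hgi] at h1
    have h2 : ξ - μ i ∈ sU i := hρs i (tsupport_mul_subset_left h1)
    have h3 : ξ - μ i + m (T.equivFin.symm i).1.1 (T.equivFin.symm i).1.2 ∈ A := h2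
    rwa [← hμ i, sub_add_cancel] at h3
  -- each piece is eventually small, by periodicity and quietness
  have hev : ∀ i, ∀ᶠ t : ℕ in atTop,
      |∫ ξ : EuclideanSpace ℝ (Fin 3), gi i ξ *
          ‖∑' s : Λ, (Real.exp (-(‖(s : EuclideanSpace ℝ (Fin 3))‖ ^ 2) / L t ^ 2) : ℂ) *
            cexp (2 * Real.pi * I * (⟪ξ, (s : EuclideanSpace ℝ (Fin 3))⟫ : ℂ))‖ ^ 2| ≤
        ε / (T.card + 1) * ∑' s : Λ, Real.exp (-(‖(s : EuclideanSpace ℝ (Fin 3))‖ ^ 2) / L t ^ 2) ^ 2 := by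
    intro i
    have hε' : 0 < ε / (T.card + 1) := div_pos hε (Nat.cast_add_one_pos _)
    have h := hq2 (fun x => gi i (x - μ i)) ((hgi_c i).comp (continuous_sub_right (μ i)))
      ((hgi_s i).comp_homeomorph (Homeomorph.subRight (μ i))) (hadm i) (ε / (T.card + 1)) hε'
    have hμV : μ i ∈ V := by rw [hμ i]; exact hmV _ _
    filter_upwards [h] with t ht
    rwa [integral_comp_sub_eq (fun z => Real.exp (-(‖z‖ ^ 2) / L t ^ 2)) (hV (μ i) hμV) (gi i)] at ht
  -- conclusion
  filter_upwards [eventually_all.2 hev, hL.eventually_gt_atTop 0] with t ht hLt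
  obtain ⟨hw, -⟩ := summable_gauss hδ hΛ hLt
  have hint : ∀ i, Integrable fun ξ : EuclideanSpace ℝ (Fin 3) => gi i ξ *
      ‖∑' s : Λ, (Real.exp (-(‖(s : EuclideanSpace ℝ (Fin 3))‖ ^ 2) / L t ^ 2) : ℂ) *
        cexp (2 * Real.pi * I * (⟪ξ, (s : EuclideanSpace ℝ (Fin 3))⟫ : ℂ))‖ ^ 2 := fun i =>
    integrable_mul_normSq_tsum (c := fun z => Real.exp (-(‖z‖ ^ 2) / L t ^ 2))
      (fun z => (Real.exp_pos _).le) hw ((hgi_c i).integrable_of_hasCompactSupport (hgi_s i))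
  have hMG : 0 ≤ ∑' s : Λ, Real.exp (-(‖(s : EuclideanSpace ℝ (Fin 3))‖ ^ 2) / L t ^ 2) ^ 2 :=
    tsum_nonneg fun s => sq_nonneg _
  have hn0 : (0 : ℝ) < T.card + 1 := Nat.cast_add_one_pos _
  have hn1 : (T.card : ℝ) * (ε / (T.card + 1)) ≤ ε := by
    rw [mul_div_assoc', div_le_iff₀ hn0]; nlinarith
  calc |∫ ξ : EuclideanSpace ℝ (Fin 3), g ξ *
          ‖∑' s : Λ, (Real.exp (-(‖(s : EuclideanSpace ℝ (Fin 3))‖ ^ 2) / L t ^ 2) : ℂ) *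
            cexp (2 * Real.pi * I * (⟪ξ, (s : EuclideanSpace ℝ (Fin 3))⟫ : ℂ))‖ ^ 2|
      = |∑ i, ∫ ξ : EuclideanSpace ℝ (Fin 3), gi i ξ *
          ‖∑' s : Λ, (Real.exp (-(‖(s : EuclideanSpace ℝ (Fin 3))‖ ^ 2) / L t ^ 2) : ℂ) *
            cexp (2 * Real.pi * I * (⟪ξ, (s : EuclideanSpace ℝ (Fin 3))⟫ : ℂ))‖ ^ 2| := by
        rw [← integral_finsetSum _ fun i _ => hint i]
        congr 1
        refine integral_congr_ae (ae_of_all _ fun ξ => ?_)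
        dsimp only
        rw [hsum ξ, Finset.sum_mul]
    _ ≤ ∑ i, |∫ ξ : EuclideanSpace ℝ (Fin 3), gi i ξ *
          ‖∑' s : Λ, (Real.exp (-(‖(s : EuclideanSpace ℝ (Fin 3))‖ ^ 2) / L t ^ 2) : ℂ) *
            cexp (2 * Real.pi * I * (⟪ξ, (s : EuclideanSpace ℝ (Fin 3))⟫ : ℂ))‖ ^ 2| :=
        Finset.abs_sum_le_sum_abs _ _
    _ ≤ ∑ _i : Fin T.card, ε / (T.card + 1) *
          ∑' s : Λ, Real.exp (-(‖(s : EuclideanSpace ℝ (Fin 3))‖ ^ 2) / L t ^ 2) ^ 2 :=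
        Finset.sum_le_sum fun i _ => ht i
    _ = (T.card : ℝ) * (ε / (T.card + 1)) *
          ∑' s : Λ, Real.exp (-(‖(s : EuclideanSpace ℝ (Fin 3))‖ ^ 2) / L t ^ 2) ^ 2 := by
        rw [Finset.sum_const, Finset.card_univ, Fintype.card_fin, nsmul_eq_mul, mul_assoc]
    _ ≤ ε * ∑' s : Λ, Real.exp (-(‖(s : EuclideanSpace ℝ (Fin 3))‖ ^ 2) / L t ^ 2) ^ 2 :=
        mul_le_mul_of_nonneg_right hn1 hMG

end HcpRigiditySpectral

/-- **Registered helper stub of `stub_essentialPeriodicityRat` (Aux file 5): quietness off the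
periodised Bragg set.** Let `Λ ⊆ ℝ³` be `δ`-separated and Gaussian-quiet along `L t → ∞` for the
admissible test functions of a periodic template `P`, and let `V` be a set of periods
(`⟨m, s⟩ ∈ ℤ`, `m ∈ V`, `s ∈ Λ`). If `g` is continuous with compact support and every point `ξ` of
`tsupport g` has some `m ∈ V` with `ξ + m ≠ 0` off every Bragg sphere, then for every `ε > 0`,
eventually `|∫ g |S_t|²| ≤ ε MG_t`. [folklore] -/
theorem stub_essentialPeriodicityRatOffSupport : ∀ (P : Literature.MathematicalPhysics.StatisticalMechanics.PeriodicConfiguration 3) (δ : ℝ), 0 < δ → ∀ Λ : Set (EuclideanSpace ℝ (Fin 3)), (∀ p ∈ Λ, ∀ q ∈ Λ, p ≠ q → δ ≤ dist p q) → ∀ L : ℕ → ℝ, Filter.Tendsto L Filter.atTop Filter.atTop → (∀ g : EuclideanSpace ℝ (Fin 3) → ℝ, Continuous g → HasCompactSupport g → (∀ ξ ∈ tsupport g, ξ ≠ 0 ∧ ∀ k : EuclideanSpace ℝ (Fin 3), (∀ v ∈ P.lattice, ∃ n : ℤ, inner ℝ k v = (n : ℝ)) → ‖ξ‖ ≠ ‖k‖)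 → ∀ ε : ℝ, 0 < ε → ∀ᶠ t : ℕ in Filter.atTop, (∫ ξ, g ξ * ‖∑' s : Λ, (Real.exp (-(‖(s : EuclideanSpace ℝ (Fin 3))‖ ^ 2) / L t ^ 2) : ℂ) * Complex.exp (2 * Real.pi * Complex.I * (inner ℝ ξ (s : EuclideanSpace ℝ (Fin 3)) : ℂ))‖ ^ 2) ≤ ε * ∑' s : Λ, Real.exp (-(‖(s : EuclideanSpace ℝ (Fin 3))‖ ^ 2) / L t ^ 2) ^ 2) → ∀ V : Set (EuclideanSpace ℝ (Fin 3)), (∀ m ∈ V, ∀ s ∈ Λ, ∃ n : ℤ, inner ℝ m s = (n : ℝ)) → ∀ g : EuclideanSpace ℝ (Fin 3) → ℝ, Continuous g → HasCompactSupport g → (∀ ξ ∈ tsupport g, ∃ m ∈ V, ξ + m ≠ 0 ∧ ∀ k : EuclideanSpace ℝ (Fin 3), (∀ v ∈ P.lattice, ∃ n : ℤ, inner ℝ k v = (n : ℝ)) → ‖ξ + m‖ ≠ ‖k‖) → ∀ ε : ℝ, 0 < ε → ∀ᶠ t : ℕ in Filter.atTop, |∫ ξ, g ξ * ‖∑' s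 : Λ, (Real.exp (-(‖(s : EuclideanSpace ℝ (Fin 3))‖ ^ 2) / L t ^ 2) : ℂ) * Complex.exp (2 * Real.pi * Complex.I * (inner ℝ ξ (s : EuclideanSpace ℝ (Fin 3)) : ℂ))‖ ^ 2| ≤ ε * ∑' s : Λ, Real.exp (-(‖(s : EuclideanSpace ℝ (Fin 3))‖ ^ 2) / L t ^ 2) ^ 2 :=
  fun _ _ hδ _ hΛ _ hL hquiet _ hV _ hgc hgs hg _ hε =>
    HcpRigiditySpectral.eventually_abs_integral_le_of_shift hδ hΛ hL hquiet hV hgc hgs hg hε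

end Summit.AtomisticToContinuum.Crystallization.Theorems

end
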